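import Literature.NumberTheory.Automorphic.ArchPlaceProjections
import Literature.NumberTheory.Automorphic.GaussDecompositionOfUnitMinors
import Literature.NumberTheory.Automorphic.BruhatCellTranslatedBigCell
import HarnessLib

/-!
# Multi-permutation translates of the big-cell chart of `GL_n(K_∞)` cover the place cells

Topic `NumberTheory/Automorphic`; namespace `Literature.NumberTheory.Automorphic`. A **multi-permutation
matrix** `ẇ(τ) ∈ GL_n(K_∞)` is a permutation matrix `P_{τ_v}` in every factor `GL_n(K_v)` of
`GL_n(K_∞) = ∏_v GL_n(K_v)` (`multiPermGL τ`, `placeGL_multiPermGL`). We prove: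

* **the big cell by leading minors** (`mem_bruhatBigCell_of_isUnit_leadMinor`): if all leading principal
  minors of `w⁰ g` are units of `K_∞`, then `g` lies in the big cell `N w⁰ A N` of `ArchBigCellChartSmooth`
  (Gauss decomposition over the commutative ring `K_∞`, `GaussDecompositionOfUnitMinors`); a leading minor
  is a unit iff it is non-zero at every place (`isUnit_leadMinor_iff`);
* **unit minors on a cell** (`leadMinor_permGL_inv_mul_ne_zero`): for `g = b P_σ u` in the Bruhat cell
  `B P_σ U_n` of `GL_n(F)`, all leading minors of `P_σ⁻¹ g = (P_σ⁻¹ b P_σ) u` are non-zero (a principal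
  submatrix of a triangular matrix on a permuted index set is triangular for the transported order);
* **coverage** (`inv_multiPermGL_mul_mem_bruhatBigCell`): if `g_v ∈ B P_{σ_v} U_n` for every place `v`, then
  `ẇ⁻¹ g` lies in the big cell for `ẇ = ẇ(v ↦ rev * σ_v)` (so that `w⁰ ẇ_v⁻¹ = P_{σ_v}⁻¹`); in particular the
  translated charts `ẇ Ψ` cover `GL_n(K_∞)` (`exists_multiPermGL_mem_bruhatBigCell`).

This is the covering of `G` by the translates `ẇ · N⁻ B` of the opposite big cell (Borel 1991, 14.12 and
Bruhat decomposition 14.11), in the form needed for the Gelfand–Kazhdan analysis of Shalika (1974),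
§2–§3. Everything is proved; no named fact is introduced.

## References

* A. Borel, *Linear Algebraic Groups*, 2nd ed. (1991), IV.14.11–14.12. [Borel1991]
* J. A. Shalika, *The multiplicity one theorem for `GL_n`*, Ann. of Math. 100 (1974), §2–§3. [Shalika1974]
-/

noncomputable section

open NumberField NumberField.InfinitePlace NumberField.mixedEmbedding Set Filter Matrix OrderDual
open scoped MatrixGroups Topology Classical

namespace Literature.NumberTheory.Automorphic

variable {n : ℕ} {K : Type} [Field K]

local notation "R∞" => mixedSpace K
local notation "Mat" => Matrix (Fin n) (Fin n) (mixedSpace K)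
local notation "G∞" => GL (Fin n) (mixedSpace K)
local notation "w₀" => ((weylLong n (mixedSpace K) : GL (Fin n) (mixedSpace K)) : Matrix (Fin n) (Fin n) (mixedSpace K))

/-! ### 1. Matrices over `K_∞` place by place -/

/-- **A matrix over `K_∞` is determined by its place images.** [folklore] -/
theorem matrix_ext_placeEmbC {m : Type*} {M N : Matrix m m (mixedSpace K)}
    (h : ∀ v : PlaceIdx K, M.map (placeEmbC v) = N.map (placeEmbC v)) : M = N :=
  Matrix.ext fun i j => ext_placeEmbC fun v => by
    have := congr_fun (congr_fun (h v) i) j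
    simpa only [Matrix.map_apply] using this

/-- A leading minor is a unit of `K_∞` iff it is non-zero at every place. [folklore] -/
theorem isUnit_leadMinor_iff (M : Mat) (a : Fin n) :
    IsUnit (leadMinor (_root_.id : Fin n → Fin n) M a) ↔
      ∀ v : PlaceIdx K, leadMinor (_root_.id : Fin n → Fin n) (M.map (placeEmbC v)) a ≠ 0 := by
  rw [isUnit_iff_placeEmbC_ne_zero]
  refine forall_congr' fun v => ?_
  rw [leadMinor_map]

/-! ### 2. Multi-permutation matrices -/

section MultiPerm

variable [NumberField K]

/-- **The multi-permutation matrix** `ẇ(τ)`: entries `ẇ_{ij} = Σ_v [τ_v i = j] 1_v`. [folklore] -/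
def multiPermMatrix (τ : PlaceIdx K → Equiv.Perm (Fin n)) : Mat :=
  fun i j => ∑ v : PlaceIdx K, if τ v i = j then (placeIdem v : R∞) else 0

/-- Components of `ẇ(τ)`: at the place `v` it is `P_{τ_v}`. [folklore] -/
theorem placeEmbC_multiPermMatrix (τ : PlaceIdx K → Equiv.Perm (Fin n)) (v : PlaceIdx K) (i j : Fin n) :
    placeEmbC v (multiPermMatrix τ i j) = if τ v i = j then 1 else 0 := by
  simp only [multiPermMatrix, map_sum]
  rw [Finset.sum_eq_single v]
  · split_ifs with h
    · rw [placeEmbC_placeIdem, if_pos rfl]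
    · rw [map_zero]
  · intro u _ hu
    split_ifs
    · rw [placeEmbC_placeIdem, if_neg (Ne.symm hu)]
    · rw [map_zero]
  · exact fun h => absurd (Finset.mem_univ v) h

/-- `ẇ(τ)` at the place `v` is the permutation matrix `P_{τ_v}`. [folklore] -/
theorem multiPermMatrix_map (τ : PlaceIdx K → Equiv.Perm (Fin n)) (v : PlaceIdx K) :
    (multiPermMatrix τ).map (placeEmbC v) = ((permGL (τ v) : GL (Fin n) ℂ) : Matrix (Fin n) (Fin n) ℂ) := by
  ext i j
  rw [Matrix.map_apply, placeEmbC_multiPermMatrix, coe_permGL, permMatrix_apply']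

/-- `ẇ(τ) ẇ(τ') = ẇ(v ↦ τ'_v τ_v)`. [folklore] -/
theorem multiPermMatrix_mul (τ τ' : PlaceIdx K → Equiv.Perm (Fin n)) :
    multiPermMatrix τ * multiPermMatrix τ' = multiPermMatrix (K := K) fun v => τ' v * τ v := by
  refine matrix_ext_placeEmbC fun v => ?_
  rw [Matrix.map_mul, multiPermMatrix_map, multiPermMatrix_map, multiPermMatrix_map, ← Units.val_mul, permGL_mul_permGL]

/-- `ẇ(1) = 1`. [folklore] -/
theorem multiPermMatrix_one : multiPermMatrix (K := K) (fun _ : PlaceIdx K => (1 : Equiv.Perm (Fin n))) = 1 := by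
  refine matrix_ext_placeEmbC fun v => ?_
  rw [multiPermMatrix_map, permGL_one, Units.val_one, Matrix.map_one _ (map_zero _) (map_one _)]

/-- **The multi-permutation matrix as an element of `GL_n(K_∞)`.** [folklore] -/
def multiPermGL (τ : PlaceIdx K → Equiv.Perm (Fin n)) : G∞ :=
  ⟨multiPermMatrix τ, multiPermMatrix fun v => (τ v)⁻¹, by
    rw [multiPermMatrix_mul]; simp only [inv_mul_cancel]; exact multiPermMatrix_one, by
    rw [multiPermMatrix_mul]; simp only [mul_inv_cancel]; exact multiPermMatrix_one⟩

/-- The matrix of `multiPermGL τ`. [folklore] -/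
@[simp] theorem coe_multiPermGL (τ : PlaceIdx K → Equiv.Perm (Fin n)) :
    ((multiPermGL τ : G∞) : Mat) = multiPermMatrix τ := rfl

/-- `(multiPermGL τ)⁻¹ = multiPermGL τ⁻¹`. [folklore] -/
theorem multiPermGL_inv (τ : PlaceIdx K → Equiv.Perm (Fin n)) :
    (multiPermGL τ : G∞)⁻¹ = multiPermGL fun v => (τ v)⁻¹ :=
  Units.ext rfl

/-- **`ẇ(τ)` at the place `v` is `P_{τ_v}`.** [folklore] -/
theorem placeGL_multiPermGL (τ : PlaceIdx K → Equiv.Perm (Fin n)) (v : PlaceIdx K) :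
    placeGL v (multiPermGL τ : G∞) = (permGL (τ v) : GL (Fin n) ℂ) :=
  Units.ext (by rw [coe_placeGL, coe_multiPermGL, multiPermMatrix_map])

omit [NumberField K] in
/-- `w⁰` at every place is `P_{rev}`. [folklore] -/
theorem weylLong_map (v : PlaceIdx K) :
    (w₀ : Mat).map (placeEmbC v) = ((permGL (Fin.revPerm : Equiv.Perm (Fin n)) : GL (Fin n) ℂ) : Matrix (Fin n) (Fin n) ℂ) := by
  ext i j
  have h := weylLong_mul_apply (1 : Mat) i j
  rw [Matrix.mul_one] at h
  rw [Matrix.map_apply, coe_permGL, permMatrix_apply', Fin.revPerm_apply, h, Matrix.one_apply]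
  split_ifs <;> simp

end MultiPerm

/-! ### 3. The big cell by leading minors -/

/-- `w⁰ ℓ w⁰ - 1` is strictly upper for `ℓ` lower unitriangular. [folklore] -/
theorem weylLong_conj_sub_one_mem_strictUpper {ℓ : Mat} (hℓ : IsBlockLowerUnipotent (_root_.id : Fin n → Fin n) ℓ) :
    w₀ * ℓ * w₀ - 1 ∈ strictUpper n R∞ := by
  intro i j hji
  rw [Matrix.sub_apply, weylLong_conj_apply, Matrix.one_apply]
  rcases lt_or_eq_of_le hji with hlt | heq
  · rw [if_neg (ne_of_gt hlt), hℓ.1 (show toDual (_root_.id j.rev) < toDual (_root_.id i.rev) from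
      toDual_lt_toDual.2 (Fin.rev_lt_rev.2 hlt)), sub_zero]
  · subst heq; rw [if_pos rfl, hℓ.2 _ _ rfl, Matrix.one_apply_eq, sub_self]

/-- `r - 1` is strictly upper for `r` upper unitriangular. [folklore] -/
theorem sub_one_mem_strictUpper_of_isBlockUpperUnipotent {r : Mat} (hr : IsBlockUpperUnipotent (_root_.id : Fin n → Fin n) r) :
    r - 1 ∈ strictUpper n R∞ := by
  intro i j hji
  rw [Matrix.sub_apply, Matrix.one_apply]
  rcases lt_or_eq_of_le hji with hlt | heq
  · rw [if_neg (ne_of_gt hlt), hr.1 hlt, sub_zero]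
  · subst heq; rw [if_pos rfl, hr.2 _ _ rfl, Matrix.one_apply_eq, sub_self]

/-- **The big cell by leading minors**: if all leading principal minors of `w⁰ g` are units of `K_∞`, then
`g ∈ N w⁰ A N` (`bruhatBigCell`): `w⁰ g = ℓ diag(d) r` gives `g = (w⁰ ℓ w⁰) w⁰ diag(d) r = Ψ(w⁰ ℓ w⁰ - 1, d, r - 1)`.
[cite: Borel1991, IV.14.12] -/
theorem mem_bruhatBigCell_of_isUnit_leadMinor [NumberField K] {g : G∞}
    (h : ∀ a : Fin n, IsUnit (leadMinor (_root_.id : Fin n → Fin n) (w₀ * (g : Mat)) a)) :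
    (g : Mat) ∈ bruhatBigCell n R∞ := by
  have hdet : IsUnit (w₀ * (g : Mat)).det := by
    rw [← Units.val_mul]; exact Matrix.isUnits_det_units _
  obtain ⟨ℓ, d, r, hℓ, hr, hfac⟩ := exists_gauss_decomposition_of_isUnit_leadMinor _ h hdet
  have hww : w₀ * w₀ = 1 := weylLong_mul_weylLong
  have hg : (g : Mat) = w₀ * ℓ * Matrix.diagonal (fun i => (d i : R∞)) * r := by
    calc (g : Mat) = w₀ * w₀ * (g : Mat) := by rw [hww, Matrix.one_mul]
      _ = w₀ * (w₀ * (g : Mat)) := by rw [Matrix.mul_assoc]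
      _ = w₀ * ℓ * Matrix.diagonal (fun i => (d i : R∞)) * r := by rw [hfac]; noncomm_ring
  set e : CellParam n R∞ := (⟨w₀ * ℓ * w₀ - 1, weylLong_conj_sub_one_mem_strictUpper hℓ⟩, fun i => (d i : R∞),
    ⟨r - 1, sub_one_mem_strictUpper_of_isBlockUpperUnipotent hr⟩) with he
  have hesrc : e ∈ cellSource n R∞ := fun i => Units.isUnit (d i)
  rw [bruhatBigCell_eq_image]
  refine ⟨e, hesrc, ?_⟩
  rw [cellChart_apply, hg]
  change (1 + (w₀ * ℓ * w₀ - 1)) * w₀ * Matrix.diagonal (fun i => (d i : R∞)) * (1 + (r - 1)) = _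
  rw [add_sub_cancel, add_sub_cancel,
    show w₀ * ℓ * w₀ * w₀ = w₀ * ℓ * (w₀ * w₀) by noncomm_ring, hww, Matrix.mul_one]

/-! ### 4. Unit minors of `P_σ⁻¹ g` on the cell `B P_σ U_n` -/

section Field

variable {F : Type*} [Field F]

/-- **A principal submatrix of an upper triangular matrix on an injectively re-indexed set has determinant
the product of the diagonal entries** (it is upper triangular for the transported order). [folklore] -/
theorem det_submatrix_of_blockTriangular_id {ι : Type*} [Fintype ι] [DecidableEq ι] {b : Matrix (Fin n) (Fin n) F}
    (hb : b.BlockTriangular (_root_.id : Fin n → Fin n)) (f : ι → Fin n) (hf : Function.Injective f) :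
    (b.submatrix f f).det = ∏ p, b (f p) (f p) := by
  letI : LinearOrder ι := LinearOrder.lift' f hf
  have htri : (b.submatrix f f).BlockTriangular (_root_.id : ι → ι) := by
    intro p q hqp
    rw [Matrix.submatrix_apply]
    exact hb hqp
  rw [Matrix.det_of_upperTriangular htri]
  rfl

/-- **Unit minors on a Bruhat cell**: for `g = b P_σ u ∈ B P_σ U_n`, every leading principal minor of
`P_σ⁻¹ g` is non-zero. [cite: Borel1991, IV.14.12] -/
theorem leadMinor_permGL_inv_mul_ne_zero {σ : Equiv.Perm (Fin n)} {g : GL (Fin n) F} (hg : g ∈ bruhatCell (K := F) σ)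
    (a : Fin n) :
    leadMinor (_root_.id : Fin n → Fin n) ((((permGL σ)⁻¹ * g : GL (Fin n) F)) : Matrix (Fin n) (Fin n) F) a ≠ 0 := by
  obtain ⟨b, hb, u, hu, rfl⟩ := hg
  have hfac : (permGL σ)⁻¹ * (b * permGL σ * u) = ((permGL σ)⁻¹ * b * permGL σ) * u := by group
  rw [hfac, Units.val_mul, leadMinor_mul_of_blockTriangular _ ((mem_upperUnitriangular_iff _).1 hu).1]
  refine mul_ne_zero ?_ ?_
  · -- the conjugate `P_σ⁻¹ b P_σ` has entries `b (σ⁻¹ i) (σ⁻¹ j)`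
    have happly : ∀ i j, ((((permGL σ)⁻¹ * b * permGL σ : GL (Fin n) F)) : Matrix (Fin n) (Fin n) F) i j =
        (b : Matrix (Fin n) (Fin n) F) (σ.symm i) (σ.symm j) := fun i j => by
      rw [Units.val_mul, Units.val_mul, permGL_inv, permGL_mul_mul_permGL_apply, Equiv.Perm.inv_def]
    have hblock : leadBlock (_root_.id : Fin n → Fin n) ((((permGL σ)⁻¹ * b * permGL σ : GL (Fin n) F)) : Matrix (Fin n) (Fin n) F) a =
        (b : Matrix (Fin n) (Fin n) F).submatrix (fun i : {i : Fin n // _root_.id i < a} => σ.symm i)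
          (fun i : {i : Fin n // _root_.id i < a} => σ.symm i) := by
      ext i j
      rw [leadBlock, toBlock_apply, happly, Matrix.submatrix_apply]
    rw [leadMinor, hblock, det_submatrix_of_blockTriangular_id hb _ (fun i j hij => Subtype.ext (σ.symm.injective hij))]
    exact Finset.prod_ne_zero_iff.2 fun p _ => diagEntries_ne_zero hb _
  · rw [((mem_upperUnitriangular_iff _).1 hu |> fun h => IsBlockUpperUnipotent.leadMinor_eq_one
      (r := (u : Matrix (Fin n) (Fin n) F)) ⟨h.1, fun i j hij => by
        have hij' : i = j := hij
        subst hij'; rw [h.2 i, Matrix.one_apply_eq]⟩ a)]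
    exact one_ne_zero

end Field

/-! ### 5. Coverage by translated charts -/

section Coverage

variable [NumberField K]

/-- **Coverage**: if `g_v ∈ B P_{σ_v} U_n` at every place, then `ẇ⁻¹ g` lies in the big cell for
`ẇ = ẇ(v ↦ rev * σ_v)`, i.e. `g ∈ ẇ · Ψ(cellSource)`. [cite: Borel1991, IV.14.11–14.12] -/
theorem inv_multiPermGL_mul_mem_bruhatBigCell (g : G∞) (σ : PlaceIdx K → Equiv.Perm (Fin n))
    (hσ : ∀ v, placeGL v g ∈ bruhatCell (K := ℂ) (σ v)) :
    ((((multiPermGL fun v => Fin.revPerm * σ v : G∞))⁻¹ * g : G∞) : Mat) ∈ bruhatBigCell n R∞ := by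
  set wd : G∞ := multiPermGL fun v => Fin.revPerm * σ v with hwd
  refine mem_bruhatBigCell_of_isUnit_leadMinor fun a => (isUnit_leadMinor_iff _ a).2 fun v => ?_
  -- at the place `v`: `w⁰ ẇ_v⁻¹ g_v = P_{σ_v}⁻¹ g_v`
  have hmap : (w₀ * ((wd⁻¹ * g : G∞) : Mat)).map (placeEmbC v) =
      ((((permGL (σ v))⁻¹ * placeGL v g : GL (Fin n) ℂ)) : Matrix (Fin n) (Fin n) ℂ) := by
    rw [Matrix.map_mul, weylLong_map, ← coe_placeGL, map_mul, map_inv, hwd, placeGL_multiPermGL, ← Units.val_mul]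
    congr 1
    rw [← permGL_mul_permGL, _root_.mul_inv_rev, mul_assoc, mul_inv_cancel_left]
  rw [hmap]
  exact leadMinor_permGL_inv_mul_ne_zero (hσ v) a

/-- **The translated charts cover `GL_n(K_∞)`.** [folklore] -/
theorem exists_multiPermGL_mem_bruhatBigCell (g : G∞) :
    ∃ τ : PlaceIdx K → Equiv.Perm (Fin n), (((multiPermGL τ : G∞)⁻¹ * g : G∞) : Mat) ∈ bruhatBigCell n R∞ := by
  choose σ hσ using fun v : PlaceIdx K => exists_mem_placeCell v g
  exact ⟨fun v => Fin.revPerm * σ v, inv_multiPermGL_mul_mem_bruhatBigCell g σ fun v => (mem_placeCell_iff v (σ v) g).1 (hσ v)⟩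

end Coverage

end Literature.NumberTheory.Automorphic
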